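import Mathlib
import Literature.Probability.LatticeModels.ScalingLimit3D

/-!
# Sketch — first lemmas for the crux-idea cards on `ExistsScaleCovariantLimit`
(crux stmt-CriticalPhenomena-1981; planner crux-ideate, round 1, ideator 3).

Statements only (`def … : Prop`), elaborated against Mathlib + the Literature tree.
-/

noncomputable section

open Filter Topology MeasureTheory

namespace Summit.CriticalPhenomena.Ising3DConformalLimit.Cruxes.ExistsScaleCovariantLimit

open Literature.Probability.LatticeModels

/-! ## Card `markov-zoom-rigidity` — Gaussian shadow of ZoomRigidity (pure complex analysis) -/

/-- **Dyadic entire rigidity** (Gaussian shadow of "a germ-Markov, reflection-positive,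
translation-invariant field cannot be discretely-but-not-continuously scale covariant").
If `P : ℂ³ → ℂ` is entire, real and `≥ 0` on `ℝ³`, not identically zero on `ℝ³`, satisfies the
DYADIC homogeneity `P(2k) = 2^m P(k)` on `ℝ³` for some `m ∈ (0,3)`, and `1/P` is locally integrable
on `ℝ³`, then `m = 2` and `P|ℝ³` is a positive-definite quadratic form (hence homogeneous under ALL
dilations). Proof: Taylor coefficients `c_α 2^{|α|} = 2^m c_α` force `c_α = 0` unless `|α| = m`;
then as in `HomogeneousEntireRigidity` (MarkovRigidity, item 6231). With Kotani 1973, Thm 2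
(`σ⁻¹` entire of minimal exponential type ⇔ germ-Markov) this says: a stationary Gaussian Markov field
on `ℝ³` covariant under `x ↦ 2x` with weight `Δ` (`σ⁻¹(2k) = 2^{3-2Δ} σ⁻¹(k)`) is the massless free
field of a metric, `Δ = 1/2`, covariant under every dilation — no Gaussian Markov limit cycle. -/
def DyadicEntireRigidity : Prop :=
  ∀ (m : ℝ) (P : (Fin 3 → ℂ) → ℂ), 0 < m → m < 3 → (∀ z, AnalyticAt ℂ P z) →
    (∃ k : Fin 3 → ℝ, P (fun i => (k i : ℂ)) ≠ 0) →
    (∀ k : Fin 3 → ℝ, 0 ≤ (P (fun i => (k i : ℂ))).re ∧ (P (fun i => (k i : ℂ))).im = 0) →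
    (∀ k : Fin 3 → ℝ, P (fun i => ((2 * k i : ℝ) : ℂ)) = (((2 : ℝ) ^ m : ℝ) : ℂ) * P (fun i => (k i : ℂ))) →
    LocallyIntegrable (fun k : Fin 3 → ℝ => 1 / (P (fun i => (k i : ℂ))).re) →
    m = 2 ∧ ∃ Q : Matrix (Fin 3) (Fin 3) ℝ, Q.PosDef ∧
      ∀ k : Fin 3 → ℝ, (P (fun i => (k i : ℂ))).re = ∑ i, ∑ j, Q i j * k i * k j

/-- **Bounded-zoom entire rigidity** (Gaussian shadow of ZoomRigidity for compact dilation-INVARIANT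
sets, not only periodic orbits): if `P : ℂ³ → ℂ` is entire, real `≥ 0` and not identically zero on
`ℝ³`, `1/P` locally integrable on `ℝ³`, and for some `m ∈ (0,3)` the whole zoom orbit
`{c^{-m} P(c·) : c > 0}` is uniformly bounded on the closed unit ball of `ℂ³`, then `P|ℝ³` is a
positive-definite quadratic form and `m = 2`. Proof: Cauchy estimates give `|c_α| c^{|α|-m} ≤ B` for
all `c > 0`, so `c_α = 0` unless `|α| = m`. Reading: every compact set of Markov Gaussian symbols
invariant under the zoom group consists of zoom-FIXED points (massless free fields of metrics). -/
def BoundedZoomEntireRigidity : Prop :=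
  ∀ (m : ℝ) (P : (Fin 3 → ℂ) → ℂ), 0 < m → m < 3 → (∀ z, AnalyticAt ℂ P z) →
    (∃ k : Fin 3 → ℝ, P (fun i => (k i : ℂ)) ≠ 0) →
    (∀ k : Fin 3 → ℝ, 0 ≤ (P (fun i => (k i : ℂ))).re ∧ (P (fun i => (k i : ℂ))).im = 0) →
    (∃ B : ℝ, ∀ (c : ℝ), 0 < c → ∀ z : Fin 3 → ℂ, ‖z‖ ≤ 1 →
        ‖(((c ^ (-m) : ℝ)) : ℂ) * P (fun i => (c : ℂ) * z i)‖ ≤ B) →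
    LocallyIntegrable (fun k : Fin 3 → ℝ => 1 / (P (fun i => (k i : ℂ))).re) →
    m = 2 ∧ ∃ Q : Matrix (Fin 3) (Fin 3) ℝ, Q.PosDef ∧
      ∀ k : Fin 3 → ℝ, (P (fun i => (k i : ℂ))).re = ∑ i, ∑ j, Q i j * k i * k j

/-! ## Card `nstar-does-the-covariance` — what existence alone already gives -/

/-- **Automatic covariance.** If the critical `ℤ³` correlators have a pointwise scaling limit `S`
along the FULL filter for some renormalisation `ρ > 0` on `(0,1]`, each `S n` is continuous on the
non-coincident configurations and `S 2` is not identically zero there, then — with NO further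
lattice input beyond what the tree proves (MMS monotonicity, the window `scalingDimension_mem_Icc`) —
the normalised family `S' := S·𝟙_{NonCoincident}` already satisfies every clause of the crux
`ExistsScaleCovariantLimit`: it is a scaling limit with the same `ρ`, vanishes off `NonCoincident`,
has `S'₂ > 0` there, is translation invariant and scale covariant with some `Δ ∈ [1/2, 1]`.
Mechanism: `[c x/δ] = [x/(δ/c)]` exactly, so `ρ(δ)/ρ(δ/c) → φ(c)` with `φ` multiplicative and (by
continuity of `c ↦ S₂(c x₀)`) continuous, hence `φ(c) = c^{-Δ}`; lattice translations shift
configurations by `O(δ)`, absorbed by continuity. So the crux is PURE EXISTENCE + CONTINUITY. -/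
def AutomaticCovariance : Prop :=
  ∀ (ρ : ℝ → ℝ) (S : CorrFamily 3), (∀ δ ∈ Set.Ioc (0:ℝ) 1, 0 < ρ δ) →
    HasPointwiseScalingLimit (criticalCorr 3) ρ S →
    (∀ n, ContinuousOn (S n) (NonCoincident 3 n)) →
    (∃ x ∈ NonCoincident 3 2, S 2 x ≠ 0) →
    ∃ Δ : ℝ, 1/2 ≤ Δ ∧ Δ ≤ 1 ∧
      HasPointwiseScalingLimit (criticalCorr 3) ρ (fun n => (NonCoincident 3 n).indicator (S n)) ∧
      (∀ n z, z ∉ NonCoincident 3 n → (fun n => (NonCoincident 3 n).indicator (S n)) n z = 0) ∧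
      IsNondegenerateTwoPoint (fun n => (NonCoincident 3 n).indicator (S n)) ∧
      IsTranslationInvariant (fun n => (NonCoincident 3 n).indicator (S n)) ∧
      IsScaleCovariant Δ (fun n => (NonCoincident 3 n).indicator (S n))

/-- **Coprime upgrade (elementary, arithmetic of `ℕ*`).** A real sequence that is slowly
oscillating in the multiplicative sense and converges to the SAME limit `L` along every sequence
`k ↦ 3^b · 2^k` (`b ∈ ℕ` fixed) converges to `L`. (Density of `{a + b·log₂3 mod 1 : b ≤ B}` as
`B → ∞`, i.e. irrationality of `log 3 / log 2`, plus uniformity over the finitely many `b ≤ B`.)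
Reading for the crux: slow oscillation (a-priori regularity) + convergence along ONE geometric mesh
sequence + covariance of that dyadic limit under ONE multiplicatively independent integer dilation
⇒ convergence along all integers (and, with local uniformity, along the full filter `δ → 0⁺`). -/
def CoprimeUpgrade : Prop :=
  ∀ (u : ℕ → ℝ) (L : ℝ),
    (∀ ε > 0, ∃ η > 0, ∃ N : ℕ, ∀ n m : ℕ, N ≤ n → N ≤ m →
        |(m : ℝ) / (n : ℝ) - 1| < η → |u m - u n| < ε) →
    (∀ b : ℕ, Tendsto (fun k : ℕ => u (3 ^ b * 2 ^ k)) atTop (𝓝 L)) →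
    Tendsto u atTop (𝓝 L)


/-! ## Card `block-zoom-exact-orbit` — tightness is free; bad scales are degenerate points -/

/-- **Top-heavy scales** (provable now from `criticalTwoPoint_bounds_holds` and the `ℓ^∞`
Messager–Miracle-Solé monotonicity `G(x) ≤ G(‖x‖_∞ e₁)`): for every multiple `m ≥ 1` there is
`c > 0` such that, for infinitely many `L`, the truncated susceptibility `χ_L = Σ_{‖x‖_∞ ≤ L} G(x)` is
carried by the top scale, `c·χ_L ≤ L³·G(mL·e₁)`. Proof: otherwise `χ_{2mL} − χ_{mL} ≤ C (mL)³ G(mL e₁)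
= o(χ_{mL})` makes the non-decreasing `χ` slowly varying, contradicting Simon's `χ_L ≥ c' L`
(from `G ≥ c‖x‖⁻²`). -/
def TopHeavyScales : Prop :=
  ∀ m : ℕ, 1 ≤ m → ∃ c : ℝ, 0 < c ∧ ∃ᶠ L : ℕ in atTop,
    c * ∑ x ∈ box 3 L, criticalTwoPoint 3 x
      ≤ (L : ℝ) ^ 3 * criticalTwoPoint 3 (fun i => if i = 0 then (m : ℤ) * L else 0)

/-- **Block-variance splitting at top-heavy scales** (the non-white witness; provable now from
`TopHeavyScales`, Griffiths positivity and `G(z) ≥ G(‖z‖₁ e₁)`): with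
`V(L) := Σ_{x,y ∈ box L} G(x − y)` (the variance of the block spin of `box L = {−L,…,L}³`), for
infinitely many `L` the block of side `4L+3` (which contains 8 disjoint translates of `box L`) has
`V(2L+1) ≥ 8(1+c)·V(L)`: the eight sub-blocks stay correlated, so the block-normalised field along
these meshes has a cluster point that is NOT white noise. -/
def BlockVarianceSplitting : Prop :=
  ∃ c : ℝ, 0 < c ∧ ∃ᶠ L : ℕ in atTop,
    (1 + c) * 8 * ∑ x ∈ box 3 L, ∑ y ∈ box 3 L, criticalTwoPoint 3 (x - y)
      ≤ ∑ x ∈ box 3 (2 * L + 1), ∑ y ∈ box 3 (2 * L + 1), criticalTwoPoint 3 (x - y)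

end Summit.CriticalPhenomena.Ising3DConformalLimit.Cruxes.ExistsScaleCovariantLimit

end
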